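import Mathlib
import Summits.Ventures.PercRepro.TriangleCapTopFourteen

/-!
# PercRepro — THE LOCI OF THE THIRD BAND (p3, gen 50; part 226)

By the vertex decomposition a vertex `w` of degree `s − 3` of a triangle-free graph `H` with `s` edges has
`Σ h² = (s − 3)² + (s − 3) + 6 + 2·attach + offAdjPairs`, i.e. `Σ h² + 6 (s − 4) + 2 j = s (s + 1)` with
`2 j = 12 − 2·attach − offAdjPairs` (`attach ≤ 3`, `offAdjPairs ≤ 6`, even).  So (`third_band_locus`, `s ≥ 15`): a
graph at the third-band value `s (s + 1) − 6 (s − 4) − 2 j` has maximum degree `s − 3` at a vertex `w` with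
`2·attach + offAdjPairs + 2 j = 12` — `j` counts the missed incidences of the three off-edges with `N(w)` (each
`≤ 1`) plus the non-intersecting pairs among them.  On the cell (`cherry_third_band_locus`, `15 ≤ r`,
`6 (r − 4) + 12 < stabGapFull k a r`): a `K₄⁻`-free graph at `closed − (6 (r − 4) + 2 j)` is `a`-bipartite with such a
vertex in its missing graph.  Axioms: standard.
-/

namespace PercRepro

namespace TriangleCap

namespace C047

open Finset

variable {V : Type*} [Fintype V] [DecidableEq V]

/-- **THE THIRD-BAND LOCI OF THE PAIR COUNT** (`s ≥ 15`, `j ≤ 6`): `Σ h² + 6 (s − 4) + 2 j = s (s + 1)` forces a vertex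
`w` of degree `s − 3` (three off-edges) with `2·attach + offAdjPairs + 2 j = 12`. -/
theorem third_band_locus (H : SimpleGraph V) [DecidableRel H.Adj] (hfree : H.CliqueFree 3) (s : ℕ)
    (hs : 15 ≤ s) (hm : H.edgeFinset.card = s) (j : ℕ) (hj : j ≤ 6)
    (hS : ∑ v, deg H v * deg H v + 6 * (s - 4) + 2 * j = s * (s + 1)) :
    ∃ w, deg H w + 3 = s ∧ (offEdges H w).card = 3 ∧ 2 * attach H w + offAdjPairs H w + 2 * j = 12 := by
  obtain ⟨w, hwmax, hoff, j', hj', hlayer⟩ := pair_count_layer H hfree (by omega)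
  rw [hm] at hoff hlayer
  obtain ⟨t, ht⟩ : ∃ t, (offEdges H w).card = t := ⟨_, rfl⟩
  rw [ht] at hoff hj' hlayer
  have ht3 : t = 3 := by
    by_contra hne
    rcases Nat.lt_or_gt_of_ne hne with hlt3 | hgt3
    · interval_cases t
      · simp only [zero_mul, mul_zero, add_zero] at hlayer
        omega
      · have e : deg H w - 1 = s - 2 := by omega
        rw [e, one_mul] at hlayer
        omega
      · have e : 2 * (deg H w - 1) = 2 * (s - 3) := by omega
        rw [e, ← mul_assoc] at hlayer
        omega
    · have hΔ : ∀ v, deg H v + 3 + 1 ≤ H.edgeFinset.card := fun v => by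
        have := hwmax v
        omega
      have := sum_deg_sq_le_of_maxdeg_level H hfree 3 (by omega) hΔ
      rw [hm] at this
      have e : 2 * ((3 + 1) * (s - 3 - 2)) = 8 * (s - 5) := by omega
      rw [e] at this
      omega
  subst ht3
  refine ⟨w, by omega, ht, ?_⟩
  have hdec := sum_deg_sq_vertex_decomposition H w
  rw [ht] at hdec
  obtain ⟨d, hd⟩ : ∃ d, deg H w = d := ⟨_, rfl⟩
  rw [hd] at hdec hoff
  have hA := attach_le H hfree w
  have hP := offAdjPairs_add_le H w
  rw [ht] at hA hP
  obtain ⟨d', rfl⟩ : ∃ d', d = d' + 1 := ⟨d - 1, by omega⟩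
  have hs' : s = d' + 4 := by omega
  subst hs'
  have e1 : (d' + 4) * (d' + 4 + 1) = d' * d' + 9 * d' + 20 := by ring
  have e2 : d' + 4 - 4 = d' := by omega
  rw [e1, e2] at hS
  have e3 : (d' + 1) * (d' + 1) = d' * d' + 2 * d' + 1 := by ring
  rw [e3] at hdec
  omega

/-- **THE THIRD-BAND LOCI ON THE CELL** (`3 ≤ a`, `15 ≤ r`, `2 a + r ≤ k` (`r + 7 ≤ k` at `a = 3`), `j ≤ 6`,
`6 (r − 4) + 12 < stabGapFull k a r`): a `K₄⁻`-free graph at `closed − (6 (r − 4) + 2 j)` is `a`-bipartite and its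
missing graph has a vertex `w` of degree `r − 3` with `2·attach + offAdjPairs + 2 j = 12`. -/
theorem cherry_third_band_locus (k a r : ℕ) (ha3 : 3 ≤ a) (hr15 : 15 ≤ r) (hk : 2 * a + r ≤ k)
    (hk3 : a = 3 → r + 7 ≤ k) (j : ℕ) (hj : j ≤ 6) (hlt : 6 * (r - 4) + 12 < stabGapFull k a r)
    (D : SimpleGraph (Fin k)) [DecidableRel D.Adj] (hK : K4mFree D) (hm : D.edgeFinset.card + r = a * (k - a))
    (heq : ∑ v, deg D v * deg D v + r * (k - 1 - r) + (6 * (r - 4) + 2 * j) = D.edgeFinset.card * k) :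
    ∃ A : Finset (Fin k), A.card = a ∧ BipSub D A ∧
      ∃ w, deg (missingGraph D A) w + 3 = r ∧ (offEdges (missingGraph D A) w).card = 3 ∧
        2 * attach (missingGraph D A) w + offAdjPairs (missingGraph D A) w + 2 * j = 12 := by
  have hcard : Fintype.card (Fin k) = k := Fintype.card_fin k
  have hbip : ∃ A : Finset (Fin k), A.card = a ∧ BipSub D A := by
    by_contra hnb
    have h := (stab_table_rows_ge_three k a r ha3 hk (by omega) hk3).1 D hK hm hnb
    omega
  obtain ⟨A, hA, hB⟩ := hbip
  refine ⟨A, hA, hB, ?_⟩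
  have hH := bipSub_sum_deg_sq_add_disjEdgePairs D A hB a r hA (by rw [hcard]; exact hm) (by rw [hcard]; omega)
  rw [hcard] at hH
  have hr : (missingGraph D A).edgeFinset.card = r := card_edges_missingGraph D A hB a r hA (by rw [hcard]; exact hm)
  have hid := sum_deg_sq_add_disjEdgePairs (missingGraph D A)
  rw [hr] at hid
  have hS : ∑ v, deg (missingGraph D A) v * deg (missingGraph D A) v + 6 * (r - 4) + 2 * j = r * (r + 1) := by
    omega
  exact third_band_locus (missingGraph D A) (cliqueFree_of_bipSub _ A (bipSub_missingGraph D A)) r hr15 hr j hj hS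

end C047

end TriangleCap

end PercRepro
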